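import Literature.NumberTheory.QuadraticFields.HurwitzClassNumberIntegrality
import Literature.NumberTheory.QuadraticFields.FundamentalDiscriminant
import Literature.NumberTheory.QuadraticFields.ImaginaryQuadraticClassNumberValues
import Literature.NumberTheory.EllipticCurves.HeegnerFieldOfDiscriminantProofs
import Summits.BirchSwinnertonDyer.BirchSwinnertonDyer.Theorems.PrintCFramBottomClassIndexLawFiveLeHeegnerFamilySplitting
import Mathlib.NumberTheory.LegendreSymbol.JacobiSymbol
import HarnessLib

set_option linter.dupNamespace false -- `Summit.BirchSwinnertonDyer.BirchSwinnertonDyer.Theorems.…` (summit = sub, D-0017)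
set_option autoImplicit false

/-!
# Crux `HeegnerTwistCouplingInSupply` (stmt-BirchSwinnertonDyer-21381) — THE FROBENIUS FAN `t² − 4p`, `3 ∣ t`:
# `h(d) ∣ H(4p − t²)` (as natural numbers), so a `3`-indivisible Hurwitz class number in the fan SUPPLIES a Frobenius field
# `K = ℚ(√(t² − 4p))` with `3 ∤ h_K`, `3` and `p` split, `4 < |d_K| < 4p` (card `chebotarev-digit-supply`, cruxidea seat 1 g38: lemma `DigitSupply`)

Route `BiquadraticEisensteinDescent` (cell `pub/bsd-wall`, width seat `bsd-wall-cm-bed-w4` g30; `--supports` 21381, helper). THEOREMS ONLY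
(no `def`, no named fact, no `sorry`). BSD is not proved by any of this; the crux (residual C⁺) and its registered stubs are untouched.

The card `Ideas/chebotarev-digit-supply.md` feeds the Frobenius-field `3`-descent on the Sylvester corner `W_p : y² + py = x³`
(`p ≡ 8 (mod 9)`) with a CLASS-NUMBER digit: for `t ≡ 3 (mod 27)` the slice `Σ_t H(4p − t²)` is, mod `3`, a Frobenius-trace digit of the
newform orbit `27.2.e.a`; when the digit is non-zero SOME term `H(4p − t²)` is prime to `3`, and then — this file — the Frobenius field
`K = ℚ(√(t² − 4p))` has `3 ∤ h_K`. The mechanism is Cohen's Lemma 5.3.7 along the conductor: with `t² − 4n = F²·d` (`F` the conductor,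
`d` the discriminant of the maximal order) `H(4n − t²) = Σ_{c ∣ F} h_w(c²d)` (tree: `hurwitzClassNumber_eq_sum_sq_mul_disc`), and for
`d < −4` every term is an honest form class number `h(c²d)`, a multiple of `h(d)` (Cox Thm. 7.24, tree: `classNumber_dvd_classNumber_mul_sq`).

* §1 `hurwitzClassNumber_eq_classNumber_mul` (`t² < 4n`, maximal `d < −4`: `H(4n − t²) = h(d)·S`, `S ≥ 1` natural); `ℓ ∤ num H ⟹ ℓ ∤ h(d)`.
* §2 `d` is fundamental and carries an imaginary quadratic `K` with `d_K = d`, `h_K = h(d)`; §3 the fan of a prime `p ≡ 2 (mod 3)`, `3 ∣ t`,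
  `t ≠ 0`, `t² < 4p`: `d ≡ 1 (mod 3)`, `d < −4`, `(d/3) = (d/p) = +1`, `|d| < 4p`; ★ `exists_frobeniusField_of_not_dvd_num` (`ℓ ∤ num H ⟹ ℓ ∤ h_K`).
* §4 the SLICE PIGEONHOLE over any finite set of admissible traces and ★ `digitSupply` — the card's `DigitSupply` in tree vocabulary.

HONEST FRAMING: elementary (orders in imaginary quadratic fields); the card's `SliceFormula27` (level-27 nebentypus Eichler–Selberg),
its Chebotarev statement `DigitSetInfinite` and the descent certificate are NOT touched here (the corner transfer is the companion
`…FrobeniusFanCorner`). [cite: Cohen1993, §5.3.2 Lemma 5.3.7, p. 234] [cite: Cox2013, §7.A (7.2)–(7.3), §7.D Thm. 7.24 and Cor. 7.28]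
[cite: Marcus2018, Ch. 2 Thm. 1]
-/

noncomputable section

open scoped Classical

namespace Summit.BirchSwinnertonDyer.BirchSwinnertonDyer.Theorems.FrobeniusFan

open Finset
open Literature.NumberTheory.QuadraticFields
open Literature.NumberTheory.Automorphic.Brandt
open Literature.NumberTheory.Automorphic.HeckeTraceFormulaGL2Level (ellipticConductors weightedClassNumber)
open Literature.NumberTheory.EllipticCurves (IsImaginaryQuadratic isImaginaryQuadratic_of_discr_eq_of_neg)

/-! ## §1 `H(4n − t²) = h(d)·S` with `S ∈ ℕ`, `S ≥ 1`, when the maximal discriminant `d` is `< −4` -/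

section Divisibility

variable {t : ℤ} {n : ℕ}

/-- `h_w(Δ) = h(Δ)` (form class number, `BinaryQuadraticForm.classNumber`) for `Δ < −4`. [cite: Cohen1993, §5.3.2 Lemma 5.3.7, p. 234] -/
theorem weightedClassNumber_eq_classNumber_of_lt {Δ : ℤ} (hΔ : Δ < -4) :
    weightedClassNumber Δ = (BinaryQuadraticForm.classNumber Δ : ℚ) := by
  rw [← hurwitzWeight_mul_classNumber (by omega : Δ < 0)]
  unfold hurwitzWeight
  rw [if_neg (by omega), if_neg (by omega), one_mul]

/-- **`H(4n − t²) = h(d)·S`, `S ≥ 1` a natural number**, when the discriminant `d = t_F² − 4n_F` of the maximal order (`t² − 4n = F²d`,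
`F` the conductor) satisfies `d < −4`: `H = Σ_{c ∣ F} h_w(c²d)` with `h_w(c²d) = h(c²d)` (`c²d ≤ d < −4`) and `h(d) ∣ h(c²d)` (Cox 7.24);
the term `c = 1` is `h(d)` itself. [cite: Cohen1993, §5.3.2 Lemma 5.3.7, p. 234] [cite: Cox2013, §7.D Thm. 7.24 and Cor. 7.28] -/
theorem hurwitzClassNumber_eq_classNumber_mul (h : t ^ 2 < 4 * n)
    (hd : tOf t n (conductor t n) ^ 2 - 4 * nOf t n (conductor t n) < -4) :
    ∃ S : ℕ, 0 < S ∧ hurwitzClassNumber (4 * n - t ^ 2) =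
      (BinaryQuadraticForm.classNumber (tOf t n (conductor t n) ^ 2 - 4 * nOf t n (conductor t n)) : ℚ) * S := by
  set d : ℤ := tOf t n (conductor t n) ^ 2 - 4 * nOf t n (conductor t n) with hd_def
  have hd0 : d < 0 := by omega
  have h4 : d % 4 = 0 ∨ d % 4 = 1 := (disc_conductor_neg_and_emod_four h).2
  have hpos : 0 < BinaryQuadraticForm.classNumber d := BinaryQuadraticForm.classNumber_pos hd0 h4
  -- each term is `h(d) · q_c`
  have hterm : ∀ c ∈ (conductor t n).divisors,
      weightedClassNumber ((c : ℤ) ^ 2 * d) =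
        (BinaryQuadraticForm.classNumber d : ℚ) *
          ((BinaryQuadraticForm.classNumber ((c : ℤ) ^ 2 * d) / BinaryQuadraticForm.classNumber d : ℕ) : ℚ) := by
    intro c hc
    have hc0 : c ≠ 0 := Nat.ne_of_gt (Nat.pos_of_mem_divisors hc)
    have hc1 : (1 : ℤ) ≤ (c : ℤ) ^ 2 := by
      have : (1 : ℤ) ≤ c := by exact_mod_cast Nat.pos_of_ne_zero hc0
      nlinarith
    have hcd : (c : ℤ) ^ 2 * d < -4 := by nlinarith
    rw [weightedClassNumber_eq_classNumber_of_lt hcd, ← Nat.cast_mul,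
      Nat.mul_div_cancel' (BinaryQuadraticForm.classNumber_dvd_classNumber_mul_sq hd0 h4 hc0)]
  refine ⟨∑ c ∈ (conductor t n).divisors,
      BinaryQuadraticForm.classNumber ((c : ℤ) ^ 2 * d) / BinaryQuadraticForm.classNumber d, ?_, ?_⟩
  · -- the term `c = 1` is `1`
    have h1 : 1 ∈ (conductor t n).divisors := Nat.one_mem_divisors.mpr (conductor_pos h).ne'
    refine lt_of_lt_of_le ?_ (Finset.single_le_sum (fun c _ ↦ Nat.zero_le _) h1)
    simp [Nat.div_self hpos]
  · rw [hurwitzClassNumber_eq_sum_sq_mul_disc h, Nat.cast_sum, Finset.mul_sum]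
    exact Finset.sum_congr rfl hterm

/-- **`H(4n − t²)` is a natural number multiple of `h(d)`** (same hypotheses): `num H = h(d)·S` and `den H = 1`.
[cite: Cohen1993, §5.3.2 Lemma 5.3.7, p. 234] [cite: Cox2013, §7.D Thm. 7.24] -/
theorem num_hurwitzClassNumber_eq_classNumber_mul (h : t ^ 2 < 4 * n)
    (hd : tOf t n (conductor t n) ^ 2 - 4 * nOf t n (conductor t n) < -4) :
    ∃ S : ℕ, 0 < S ∧ (hurwitzClassNumber (4 * n - t ^ 2)).num =
      (BinaryQuadraticForm.classNumber (tOf t n (conductor t n) ^ 2 - 4 * nOf t n (conductor t n)) * S : ℕ) ∧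
      (hurwitzClassNumber (4 * n - t ^ 2)).den = 1 := by
  obtain ⟨S, hS, hH⟩ := hurwitzClassNumber_eq_classNumber_mul h hd
  refine ⟨S, hS, ?_, ?_⟩
  · rw [hH, ← Nat.cast_mul]
    exact Rat.num_natCast _
  · rw [hH, ← Nat.cast_mul]
    exact Rat.den_natCast _

/-- ★ **`ℓ ∤ num H(4n − t²) ⟹ ℓ ∤ h(d)`** for every natural number `ℓ`, when the maximal discriminant `d` of `t² − 4n` is `< −4`
(`num H = h(d)·S`). [cite: Cohen1993, §5.3.2 Lemma 5.3.7, p. 234] [cite: Cox2013, §7.D Thm. 7.24] -/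
theorem not_dvd_classNumber_of_not_dvd_num (h : t ^ 2 < 4 * n)
    (hd : tOf t n (conductor t n) ^ 2 - 4 * nOf t n (conductor t n) < -4) {ℓ : ℕ}
    (hℓ : ¬ (ℓ : ℤ) ∣ (hurwitzClassNumber (4 * n - t ^ 2)).num) :
    ¬ ℓ ∣ BinaryQuadraticForm.classNumber (tOf t n (conductor t n) ^ 2 - 4 * nOf t n (conductor t n)) := by
  obtain ⟨S, -, hnum, -⟩ := num_hurwitzClassNumber_eq_classNumber_mul h hd
  intro hdvd
  refine hℓ ?_
  rw [hnum]
  exact Int.natCast_dvd_natCast.mpr (hdvd.mul_right S)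

/-- The same divisibility in natural-number currency: `H(4n − t²) = m` for a natural number `m` with `h(d) ∣ m`.
[cite: Cohen1993, §5.3.2 Lemma 5.3.7, p. 234] [cite: Cox2013, §7.D Thm. 7.24] -/
theorem exists_hurwitzClassNumber_eq_natCast_dvd (h : t ^ 2 < 4 * n)
    (hd : tOf t n (conductor t n) ^ 2 - 4 * nOf t n (conductor t n) < -4) :
    ∃ m : ℕ, hurwitzClassNumber (4 * n - t ^ 2) = m ∧
      BinaryQuadraticForm.classNumber (tOf t n (conductor t n) ^ 2 - 4 * nOf t n (conductor t n)) ∣ m := by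
  obtain ⟨S, -, hH⟩ := hurwitzClassNumber_eq_classNumber_mul h hd
  exact ⟨_, by rw [hH, ← Nat.cast_mul], Dvd.intro S rfl⟩

end Divisibility

/-! ## §2 The maximal discriminant is fundamental and carries a quadratic field (any `t² < 4n`) -/

section Field

variable {t : ℤ} {n : ℕ}

/-- **The discriminant `d = t_F² − 4n_F` of the maximal order through `(t² − 4n)` is a FUNDAMENTAL discriminant** (the order of
conductor-parameter `F` has conductor `F/F = 1`, tree `conductor_tOf_nOf`, and conductor `1` means fundamental,
`conductor_eq_one_iff_isFundamental`). [cite: Cox2013, §7.A (7.2)–(7.3) and Lemma 7.2] -/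
theorem isFundamental_disc (h : t ^ 2 < 4 * n) :
    ((tOf t n (conductor t n) ^ 2 - 4 * nOf t n (conductor t n)) % 4 = 1 ∧
        Squarefree (tOf t n (conductor t n) ^ 2 - 4 * nOf t n (conductor t n)) ∧
          tOf t n (conductor t n) ^ 2 - 4 * nOf t n (conductor t n) ≠ 1) ∨
      (4 ∣ tOf t n (conductor t n) ^ 2 - 4 * nOf t n (conductor t n) ∧
        ((tOf t n (conductor t n) ^ 2 - 4 * nOf t n (conductor t n)) / 4 % 4 = 2 ∨
          (tOf t n (conductor t n) ^ 2 - 4 * nOf t n (conductor t n)) / 4 % 4 = 3) ∧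
          Squarefree ((tOf t n (conductor t n) ^ 2 - 4 * nOf t n (conductor t n)) / 4)) := by
  have hF := conductor_mem h
  have h' := sq_lt_four_mul_nOf h hF
  have h1 : conductor (tOf t n (conductor t n)) (nOf t n (conductor t n)).toNat = 1 := by
    rw [conductor_tOf_nOf h hF, Nat.div_self (conductor_pos h)]
  have key := (conductor_eq_one_iff_isFundamental h').1 h1
  rwa [toNat_nOf h hF] at key

/-- `d·F² = t² − 4n` for the conductor `F` and the maximal discriminant `d`. [cite: Cox2013, §7.A (7.3)] -/
theorem disc_mul_conductor_sq (h : t ^ 2 < 4 * n) :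
    (tOf t n (conductor t n) ^ 2 - 4 * nOf t n (conductor t n)) * ((conductor t n : ℕ) : ℤ) ^ 2 = t ^ 2 - 4 * n := by
  rw [mul_comm]
  exact sq_mul_disc h (conductor_mem h)

/-- **The quadratic field of the maximal discriminant**: for `t² < 4n` there is an imaginary quadratic field `K` with `d_K = d`
(`= t_F² − 4n_F`) and `h_K = h(d)` (form class number) — `ℚ(√(t² − 4n))`. [cite: Marcus2018, Ch. 2 Thm. 1]
[cite: Cox2013, §2.A Thm. 2.13; §7.B Thm. 7.7(ii)] -/
theorem exists_field_discr_eq_disc (h : t ^ 2 < 4 * n) :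
    ∃ (K : Type) (_ : Field K) (_ : NumberField K),
      IsImaginaryQuadratic K ∧ NumberField.discr K = tOf t n (conductor t n) ^ 2 - 4 * nOf t n (conductor t n) ∧
        NumberField.classNumber K =
          BinaryQuadraticForm.classNumber (tOf t n (conductor t n) ^ 2 - 4 * nOf t n (conductor t n)) := by
  have hd0 : tOf t n (conductor t n) ^ 2 - 4 * nOf t n (conductor t n) < 0 := disc_tOf_neg h (conductor_mem h)
  obtain ⟨K, iF, iN, h2, hdK⟩ := Quadratic.exists_numberField_discr_eq (isFundamental_disc h)
  refine ⟨K, iF, iN, isImaginaryQuadratic_of_discr_eq_of_neg h2 hdK hd0, hdK, ?_⟩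
  rw [← BinaryQuadraticForm.binQF_classNumber_eq _ hd0]
  exact ClassNumberValues.classNumber_eq_of_discr_eq h2 hdK hd0 rfl

/-- `|d| ≤ 4n − t²` (`|d|·F² = 4n − t²`, `F ≥ 1`). [cite: Cox2013, §7.A (7.3)] -/
theorem natAbs_disc_le (h : t ^ 2 < 4 * n) :
    ((tOf t n (conductor t n) ^ 2 - 4 * nOf t n (conductor t n)).natAbs : ℤ) ≤ 4 * n - t ^ 2 := by
  have hd0 : tOf t n (conductor t n) ^ 2 - 4 * nOf t n (conductor t n) < 0 := disc_tOf_neg h (conductor_mem h)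
  have hF1 : (1 : ℤ) ≤ ((conductor t n : ℕ) : ℤ) ^ 2 := by
    have : (1 : ℤ) ≤ ((conductor t n : ℕ) : ℤ) := by exact_mod_cast conductor_pos h
    nlinarith
  have hsq := disc_mul_conductor_sq h
  rw [Int.ofNat_natAbs_of_nonpos hd0.le]
  nlinarith

end Field

/-! ## §3 The Frobenius fan of a prime `p ≡ 2 (mod 3)`: traces `3 ∣ t`, `t ≠ 0`, `t² < 4p` -/

section Fan

variable {p : ℕ} {t : ℤ}

/-- In the fan `5 ≤ p` (`9 ≤ t² < 4p` rules out `p = 2`; `p ≡ 2 (mod 3)` rules out `3`). [folklore] -/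
theorem five_le (hp : p.Prime) (hp3 : p % 3 = 2) (h3t : 3 ∣ t) (ht0 : t ≠ 0) (h : t ^ 2 < 4 * (p : ℤ)) : 5 ≤ p := by
  obtain ⟨k, rfl⟩ := h3t
  have hk : k ≠ 0 := by rintro rfl; simp at ht0
  have hk1 : 1 ≤ k ^ 2 := by
    rcases lt_or_gt_of_ne hk with hk | hk <;> nlinarith
  have h9 : (9 : ℤ) ≤ (3 * k) ^ 2 := by nlinarith
  have hp2 := hp.two_le
  have hp3' : p ≠ 3 := by rintro rfl; simp at hp3
  have hp4 : p ≠ 4 := by rintro rfl; exact absurd hp (by decide)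
  omega

/-- **`t² − 4p ≡ 1 (mod 3)`** in the fan, read in `ZMod 3`. [folklore] -/
theorem sq_sub_four_mul_zmod_three (hp3 : p % 3 = 2) (h3t : 3 ∣ t) :
    ((t ^ 2 - 4 * (p : ℤ) : ℤ) : ZMod 3) = 1 := by
  have ht : (t : ZMod 3) = 0 := (ZMod.intCast_zmod_eq_zero_iff_dvd t 3).mpr h3t
  have hpz : (p : ZMod 3) = 2 := by
    have : (p : ZMod 3) = ((p % 3 : ℕ) : ZMod 3) := by rw [ZMod.natCast_mod]
    rw [this, hp3]; rfl
  push_cast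
  rw [ht, hpz]
  decide

/-- **`d ≡ 1 (mod 3)` and `3 ∤ F`** in the fan (`F²·d = t² − 4p ≡ 1 (mod 3)`). [cite: Cox2013, §7.A (7.3)] -/
theorem disc_emod_three (hp : p.Prime) (hp3 : p % 3 = 2) (h3t : 3 ∣ t) (h : t ^ 2 < 4 * (p : ℤ)) :
    (tOf t p (conductor t p) ^ 2 - 4 * nOf t p (conductor t p)) % 3 = 1 ∧ ¬ 3 ∣ conductor t p := by
  have _ := hp
  set d : ℤ := tOf t p (conductor t p) ^ 2 - 4 * nOf t p (conductor t p) with hd_def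
  have hsq := disc_mul_conductor_sq (t := t) (n := p) h
  have hz : ((d * ((conductor t p : ℕ) : ℤ) ^ 2 : ℤ) : ZMod 3) = 1 := by
    rw [hsq]; exact sq_sub_four_mul_zmod_three hp3 h3t
  push_cast at hz
  have key : ∀ x y : ZMod 3, x * y ^ 2 = 1 → x = 1 ∧ y ≠ 0 := by decide
  obtain ⟨hd1, hF⟩ := key _ _ hz
  constructor
  · have := (ZMod.intCast_eq_intCast_iff' (a := d) (b := 1) (c := 3)).1 (by rw [hd1]; simp)
    simpa using this
  · intro h3F
    exact hF ((ZMod.natCast_eq_zero_iff _ _).mpr h3F)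

/-- **`d < −4`** in the fan: `d < 0`, `d ≡ 0, 1 (mod 4)` and `d ≡ 1 (mod 3)` exclude `d = −3, −4`. [cite: Cox2013, §7.A (7.2)–(7.3)] -/
theorem disc_lt_neg_four (hp : p.Prime) (hp3 : p % 3 = 2) (h3t : 3 ∣ t) (h : t ^ 2 < 4 * (p : ℤ)) :
    tOf t p (conductor t p) ^ 2 - 4 * nOf t p (conductor t p) < -4 := by
  obtain ⟨hneg, h4⟩ := disc_conductor_neg_and_emod_four (t := t) (n := p) h
  have h3 := (disc_emod_three hp hp3 h3t h).1
  omega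

/-- **`(d/3) = +1`** in the fan (`d ≡ 1 (mod 3)`): `3` splits in `ℚ(√d)`. [cite: Cox2013, Prop. 5.16] -/
theorem jacobiSym_disc_three (hp : p.Prime) (hp3 : p % 3 = 2) (h3t : 3 ∣ t) (h : t ^ 2 < 4 * (p : ℤ)) :
    jacobiSym (tOf t p (conductor t p) ^ 2 - 4 * nOf t p (conductor t p)) 3 = 1 := by
  have h1 : (tOf t p (conductor t p) ^ 2 - 4 * nOf t p (conductor t p)) % ((3 : ℕ) : ℤ) = 1 :=
    (disc_emod_three hp hp3 h3t h).1
  rw [jacobiSym.mod_left, h1]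
  exact jacobiSym.one_left 3

/-- `p ∤ t` in the fan (`0 < |t| < 2√p < p` as `5 ≤ p`). [folklore] -/
theorem not_dvd_trace (hp : p.Prime) (hp3 : p % 3 = 2) (h3t : 3 ∣ t) (ht0 : t ≠ 0) (h : t ^ 2 < 4 * (p : ℤ)) :
    ¬ (p : ℤ) ∣ t := by
  have h5 : (5 : ℤ) ≤ p := by exact_mod_cast five_le hp hp3 h3t ht0 h
  rintro ⟨k, rfl⟩
  have hk : k ≠ 0 := by rintro rfl; simp at ht0
  have hk1 : 1 ≤ k ^ 2 := by
    rcases lt_or_gt_of_ne hk with hk | hk <;> nlinarith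
  have h1 : ((p : ℤ) * k) ^ 2 = (p : ℤ) ^ 2 * k ^ 2 := by ring
  have h2 : (p : ℤ) ^ 2 ≤ (p : ℤ) ^ 2 * k ^ 2 := le_mul_of_one_le_right (sq_nonneg _) hk1
  nlinarith

/-- **`(d/p) = +1`** in the fan: `d·F² = t² − 4p ≡ t² ≢ 0 (mod p)`, so `d` is a non-zero square modulo `p` — `p` SPLITS in `ℚ(√d)`
(the tree's `PrintCFram.HeegnerFamily.legendreSym_eq_one_of_mul_sq_eq`). [cite: Cox2013, Prop. 5.16 and §7.A (7.3)] -/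
theorem jacobiSym_disc_prime (hp : p.Prime) (hp3 : p % 3 = 2) (h3t : 3 ∣ t) (ht0 : t ≠ 0) (h : t ^ 2 < 4 * (p : ℤ)) :
    jacobiSym (tOf t p (conductor t p) ^ 2 - 4 * nOf t p (conductor t p)) p = 1 := by
  haveI : Fact p.Prime := ⟨hp⟩
  rw [← jacobiSym.legendreSym.to_jacobiSym]
  exact PrintCFram.HeegnerFamily.legendreSym_eq_one_of_mul_sq_eq (disc_mul_conductor_sq (t := t) (n := p) h)
    (dvd_refl _) (not_dvd_trace hp hp3 h3t ht0 h)

/-- **`4 < |d| < 4p`** in the fan (`|d| ≤ 4p − t² ≤ 4p − 9`). [cite: Cox2013, §7.A (7.3)] -/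
theorem natAbs_disc_bounds (hp : p.Prime) (hp3 : p % 3 = 2) (h3t : 3 ∣ t) (ht0 : t ≠ 0) (h : t ^ 2 < 4 * (p : ℤ)) :
    4 < (tOf t p (conductor t p) ^ 2 - 4 * nOf t p (conductor t p)).natAbs ∧
      (tOf t p (conductor t p) ^ 2 - 4 * nOf t p (conductor t p)).natAbs < 4 * p := by
  have hlt := disc_lt_neg_four hp hp3 h3t h
  have hle := natAbs_disc_le (t := t) (n := p) h
  have ht1 : 1 ≤ t ^ 2 := by
    rcases lt_or_gt_of_ne ht0 with ht | ht <;> nlinarith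
  omega

/-- ★ **THE FROBENIUS FIELD OF AN ADMISSIBLE TRACE.** For a prime `p ≡ 2 (mod 3)` and `t` with `3 ∣ t`, `t ≠ 0`, `t² < 4p`: an imaginary
quadratic field `K` (`= ℚ(√(t² − 4p))`) with `d_K·F² = t² − 4p` (`F` the conductor), `4 < |d_K| < 4p`, `(d_K/3) = (d_K/p) = +1` (so `3`
and `p` split: `K` is Heegner for every level supported on `{3, p}`), and `h_K = h(d_K)` the form class number of the maximal
discriminant. [cite: Marcus2018, Ch. 2 Thm. 1] [cite: Cox2013, Prop. 5.16, §7.A (7.3), Thm. 7.7(ii)] -/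
theorem exists_frobeniusField (hp : p.Prime) (hp3 : p % 3 = 2) (h3t : 3 ∣ t) (ht0 : t ≠ 0) (h : t ^ 2 < 4 * (p : ℤ)) :
    ∃ (K : Type) (_ : Field K) (_ : NumberField K),
      IsImaginaryQuadratic K ∧ NumberField.discr K * ((conductor t p : ℕ) : ℤ) ^ 2 = t ^ 2 - 4 * p ∧
        4 < (NumberField.discr K).natAbs ∧ (NumberField.discr K).natAbs < 4 * p ∧
        jacobiSym (NumberField.discr K) 3 = 1 ∧ jacobiSym (NumberField.discr K) p = 1 ∧
        NumberField.classNumber K =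
          BinaryQuadraticForm.classNumber (tOf t p (conductor t p) ^ 2 - 4 * nOf t p (conductor t p)) := by
  obtain ⟨K, iF, iN, hK, hdK, hhK⟩ := exists_field_discr_eq_disc (t := t) (n := p) h
  obtain ⟨h4, h4p⟩ := natAbs_disc_bounds hp hp3 h3t ht0 h
  refine ⟨K, iF, iN, hK, ?_, ?_, ?_, ?_, ?_, hhK⟩
  · rw [hdK]; exact disc_mul_conductor_sq (t := t) (n := p) h
  · rwa [hdK]
  · rwa [hdK]
  · rw [hdK]; exact jacobiSym_disc_three hp hp3 h3t h
  · rw [hdK]; exact jacobiSym_disc_prime hp hp3 h3t ht0 h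

/-- ★ **DIGIT SUPPLY PER TRACE: `3 ∤ num H(4p − t²)` ⟹ the Frobenius field has `3 ∤ h_K`** (with all the side data of
`exists_frobeniusField`). The card's `DigitSupply`, one trace at a time, for every prime `p ≡ 2 (mod 3)`.
[cite: Cohen1993, §5.3.2 Lemma 5.3.7, p. 234] [cite: Cox2013, §7.D Thm. 7.24] [cite: Marcus2018, Ch. 2 Thm. 1] -/
theorem exists_frobeniusField_of_not_dvd_num (hp : p.Prime) (hp3 : p % 3 = 2) (h3t : 3 ∣ t) (ht0 : t ≠ 0)
    (h : t ^ 2 < 4 * (p : ℤ)) {ℓ : ℕ} (hℓ : ¬ (ℓ : ℤ) ∣ (hurwitzClassNumber (4 * p - t ^ 2)).num) :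
    ∃ (K : Type) (_ : Field K) (_ : NumberField K),
      IsImaginaryQuadratic K ∧ NumberField.discr K * ((conductor t p : ℕ) : ℤ) ^ 2 = t ^ 2 - 4 * p ∧
        4 < (NumberField.discr K).natAbs ∧ (NumberField.discr K).natAbs < 4 * p ∧
        jacobiSym (NumberField.discr K) 3 = 1 ∧ jacobiSym (NumberField.discr K) p = 1 ∧
        ¬ ℓ ∣ NumberField.classNumber K := by
  obtain ⟨K, iF, iN, hK, hdK, h4, h4p, hJ3, hJp, hhK⟩ := exists_frobeniusField hp hp3 h3t ht0 h
  refine ⟨K, iF, iN, hK, hdK, h4, h4p, hJ3, hJp, ?_⟩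
  rw [hhK]
  exact not_dvd_classNumber_of_not_dvd_num h (disc_lt_neg_four hp hp3 h3t h) hℓ

end Fan

/-! ## §4 The slice pigeonhole and the card's `DigitSupply` -/

section Slice

variable {p : ℕ} {t : ℤ}

/-- A finite sum of rationals each of which is an integer divisible by `ℓ` is an integer divisible by `ℓ`. [folklore] -/
theorem exists_sum_eq_intCast_dvd {ι : Type*} (S : Finset ι) (f : ι → ℚ) (ℓ : ℤ)
    (hf : ∀ i ∈ S, ∃ m : ℤ, f i = m ∧ ℓ ∣ m) : ∃ M : ℤ, ∑ i ∈ S, f i = M ∧ ℓ ∣ M := by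
  classical
  induction S using Finset.induction_on with
  | empty => exact ⟨0, by simp, dvd_zero _⟩
  | insert a s ha ih =>
    obtain ⟨M, hM, hlM⟩ := ih (fun i hi ↦ hf i (Finset.mem_insert_of_mem hi))
    obtain ⟨m, hm, hlm⟩ := hf a (Finset.mem_insert_self a s)
    exact ⟨m + M, by rw [Finset.sum_insert ha, hm, hM]; push_cast; ring, dvd_add hlm hlM⟩

/-- **THE SLICE PIGEONHOLE.** For a prime `p ≡ 2 (mod 3)` and a finite set `S` of traces with `3 ∣ t`, `t² < 4p`: if
`ℓ ∤ num Σ_{t ∈ S} H(4p − t²)` then `ℓ ∤ num H(4p − t²)` for some `t ∈ S` (all terms are natural numbers).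
[cite: Cohen1993, §5.3.2 Lemma 5.3.7, p. 234] -/
theorem exists_not_dvd_num_of_not_dvd_num_sum (hp : p.Prime) (hp3 : p % 3 = 2) (S : Finset ℤ)
    (hS : ∀ t ∈ S, 3 ∣ t ∧ t ^ 2 < 4 * (p : ℤ)) {ℓ : ℕ}
    (hsum : ¬ (ℓ : ℤ) ∣ (∑ t ∈ S, hurwitzClassNumber (4 * p - t ^ 2)).num) :
    ∃ t ∈ S, ¬ (ℓ : ℤ) ∣ (hurwitzClassNumber (4 * p - t ^ 2)).num := by
  by_contra hall
  push Not at hall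
  obtain ⟨M, hM, hlM⟩ := exists_sum_eq_intCast_dvd S (fun t ↦ hurwitzClassNumber (4 * p - t ^ 2)) ℓ (fun t ht ↦ by
    obtain ⟨m, hm, -⟩ := exists_hurwitzClassNumber_eq_natCast_dvd (hS t ht).2 (disc_lt_neg_four hp hp3 (hS t ht).1 (hS t ht).2)
    refine ⟨(hurwitzClassNumber (4 * p - t ^ 2)).num, ?_, hall t ht⟩
    rw [hm, Rat.num_natCast, Int.cast_natCast])
  refine hsum ?_
  rw [hM, Rat.num_intCast]
  exact hlM

/-- ★ **SLICE SUPPLY.** For a prime `p ≡ 2 (mod 3)` and a finite set `S` of admissible traces (`3 ∣ t`, `t ≠ 0`, `t² < 4p`): if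
`ℓ ∤ num Σ_{t ∈ S} H(4p − t²)` then some `t ∈ S` has a Frobenius field `K` (`d_K·F² = t² − 4p`, `4 < |d_K| < 4p`, `(d_K/3) = (d_K/p) = 1`)
with `ℓ ∤ h_K`. [cite: Cohen1993, §5.3.2 Lemma 5.3.7, p. 234] [cite: Cox2013, §7.D Thm. 7.24] [cite: Marcus2018, Ch. 2 Thm. 1] -/
theorem exists_frobeniusField_of_not_dvd_num_sum (hp : p.Prime) (hp3 : p % 3 = 2) (S : Finset ℤ)
    (hS : ∀ t ∈ S, 3 ∣ t ∧ t ≠ 0 ∧ t ^ 2 < 4 * (p : ℤ)) {ℓ : ℕ}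
    (hsum : ¬ (ℓ : ℤ) ∣ (∑ t ∈ S, hurwitzClassNumber (4 * p - t ^ 2)).num) :
    ∃ t ∈ S, ∃ (K : Type) (_ : Field K) (_ : NumberField K),
      IsImaginaryQuadratic K ∧ NumberField.discr K * ((conductor t p : ℕ) : ℤ) ^ 2 = t ^ 2 - 4 * p ∧
        4 < (NumberField.discr K).natAbs ∧ (NumberField.discr K).natAbs < 4 * p ∧
        jacobiSym (NumberField.discr K) 3 = 1 ∧ jacobiSym (NumberField.discr K) p = 1 ∧
        ¬ ℓ ∣ NumberField.classNumber K := by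
  obtain ⟨t, ht, hℓ⟩ := exists_not_dvd_num_of_not_dvd_num_sum hp hp3 S (fun t ht ↦ ⟨(hS t ht).1, (hS t ht).2.2⟩) hsum
  exact ⟨t, ht, exists_frobeniusField_of_not_dvd_num hp hp3 (hS t ht).1 (hS t ht).2.1 (hS t ht).2.2 hℓ⟩

/-- ★★ **THE CARD'S `DigitSupply`** (card `chebotarev-digit-supply`, «provable now»), in tree vocabulary. For a prime `p ≡ 8 (mod 9)`:
if the `3`-adic digit of the slice `N₂₇(p, 3) = Σ_{t ≡ 3 (mod 27), t² < 4p} H(4p − t²)` is non-zero (`3 ∤ num N₂₇(p, 3)`), then some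
admissible trace `t` (`3 ∣ t`, `9 ∤ t`, `t² < 4p`) has a FROBENIUS FIELD `K = ℚ(√(t² − 4p))` (`d_K·c² = t² − 4p`) with `3 ∤ h_K` — and
moreover `4 < |d_K| < 4p`, `(d_K/3) = (d_K/p) = +1`. The digit itself (a Frobenius-trace digit of `27.2.e.a` by the level-27 nebentypus
trace formula) and its non-vanishing on a Chebotarev set are NOT addressed here. [cite: Cohen1993, §5.3.2 Lemma 5.3.7, p. 234]
[cite: Cox2013, §7.D Thm. 7.24] [cite: Marcus2018, Ch. 2 Thm. 1] -/
theorem digitSupply (hp : p.Prime) (hp9 : p % 9 = 8)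
    (hdigit : ¬ (3 : ℤ) ∣ (∑ t ∈ (Finset.Ioo (-(2 * (p : ℤ))) (2 * p)).filter (fun t ↦ t % 27 = 3 ∧ t ^ 2 < 4 * (p : ℤ)),
      hurwitzClassNumber (4 * p - t ^ 2)).num) :
    ∃ t : ℤ, 3 ∣ t ∧ ¬ 9 ∣ t ∧ t ^ 2 < 4 * p ∧
      ∃ (K : Type) (_ : Field K) (_ : NumberField K),
        IsImaginaryQuadratic K ∧ (∃ c : ℕ, 0 < c ∧ NumberField.discr K * (c : ℤ) ^ 2 = t ^ 2 - 4 * p) ∧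
          4 < (NumberField.discr K).natAbs ∧ (NumberField.discr K).natAbs < 4 * p ∧
          jacobiSym (NumberField.discr K) 3 = 1 ∧ jacobiSym (NumberField.discr K) p = 1 ∧
          ¬ 3 ∣ NumberField.classNumber K := by
  have hp3 : p % 3 = 2 := by omega
  have hS : ∀ t ∈ (Finset.Ioo (-(2 * (p : ℤ))) (2 * p)).filter (fun t ↦ t % 27 = 3 ∧ t ^ 2 < 4 * (p : ℤ)),
      3 ∣ t ∧ t ≠ 0 ∧ t ^ 2 < 4 * (p : ℤ) := by
    intro t ht
    rw [Finset.mem_filter] at ht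
    exact ⟨by omega, by omega, ht.2.2⟩
  obtain ⟨t, ht, K, iF, iN, hK, hdK, h4, h4p, hJ3, hJp, h3⟩ :=
    exists_frobeniusField_of_not_dvd_num_sum hp hp3 _ hS (ℓ := 3) (by exact_mod_cast hdigit)
  rw [Finset.mem_filter] at ht
  exact ⟨t, by omega, by omega, ht.2.2, K, iF, iN, hK,
    ⟨conductor t p, conductor_pos ht.2.2, hdK⟩, h4, h4p, hJ3, hJp, h3⟩

end Slice



end Summit.BirchSwinnertonDyer.BirchSwinnertonDyer.Theorems.FrobeniusFan
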